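import Summits.CriticalPhenomena.PercolationContinuityZ3.Theorems.PercNearOneGluingNoHeavyPcintSignedConfigSplit
import HarnessLib

/-!
# CriticalPhenomena/PercolationContinuityZ3 — Theorems/PercNearOneGluingNoHeavyPcintSignedConfigCount.lean: the FIRST-ITEM RECURSION for the prefixed counting functions `G(top, W, wP, S)(N)`

Lane prim-pcint, STRUCTURE rule «numerics ⇒ structure ⇒ conjecture» (prim-pcint-2 GEN 22); sequel of …PcintSignedConfigSplit.  Counting the
first-item bijection: the configurations of `G(top, W, wP, S)` on `α` whose first item is the non-empty initial segment `I` number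
`Σ_k [CondOK_k] · #items(S.take k) on I · #G(top, W₂, wP₂, S.drop k) on Iᶜ` (`card_filter_fstItem`), and summing over the initial segments of `Fin N`:
  `gCount top W wP S N = Σ_{N₁=1}^{N} Σ_{k ≤ |S|} [CondOK_k (N₁ = N)] · iCount (S.take k) N₁ · gCount top W₂ wP₂ (S.drop k) (N − N₁)`  (`N ≥ 1`,
`gCount_succ`), with `gCount … 0 = [S = []]` (`gCount_zero`) and the item counts `iCount T 0 = 0`, `iCount T 1 = [|T| = 1]`, `iCount T (N+2) =
eCount T (N+2)` — the executable specification numerics/wrec.py of the lane reproduces `PN, Ne, Pa` from exactly this recursion.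

HONEST FRAMING: elementary finite combinatorics.  No `sorry`; standard axioms.  Written by prim-pcint-2 gen 22 (prover-prim-pcint-2-g22-0), 2026-08-27.
-/

namespace Summit.CriticalPhenomena.PercolationContinuityZ3.Theorems.Pcint.ChordDiag

variable {α : Type*} [LinearOrder α] [Fintype α]

/-! ### The fibre of the first-item map -/

/-- The number of letters of the first item is at most the number of letters. [folklore] -/
theorem length_sw_resC_le {c : Cfg α} {S : Finset α} (hS : Closed c.1 S) : (sw (resC c S)).length ≤ (sw c).length := by
  rw [length_sw_resC hS, length_sw]
  exact Finset.card_filter_le _ _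

open Classical in
/-- **The fibre count of the first-item map.** [folklore] -/
theorem card_filter_fstItem {I : Finset α} (hI : Init I) (hIne : I.Nonempty) (top : Bool) (W : List ℤ) (wP : Option ℤ) (S : List Bool) :
    ((gSet top W wP S α).filter fun c => fstItem c = I).card =
      ∑ k ∈ Finset.range (S.length + 1), (if CondOK top W wP (lwt (S.take k)) (I = Finset.univ) then 1 else 0) *
        ((itemSet (S.take k) ↥I).card * (gSet top (W2 W wP (lwt (S.take k))) (wP2 wP (lwt (S.take k))) (S.drop k) ↥(Iᶜ)).card) := by
  classical
  -- sort the fibre by the number `k` of letters in the first item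
  rw [Finset.card_eq_sum_card_fiberwise (f := fun c : Cfg α => (sw (resC c I)).length) (t := Finset.range (S.length + 1))]
  · refine Finset.sum_congr rfl fun k hk => ?_
    rw [Finset.mem_range] at hk
    set F := (gSet top W wP S α).filter fun c => fstItem c = I with hF
    set v := lwt (S.take k)
    split_ifs with hok
    · rw [one_mul, ← Finset.card_product]
      refine Finset.card_nbij' (fun c => (resC c I, resC c Iᶜ)) (fun p => glueC I p.2 p.1) ?_ ?_ ?_ ?_
      · intro c hc
        rw [Finset.mem_coe, Finset.mem_filter, hF, Finset.mem_filter, mem_gSet] at hc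
        obtain ⟨⟨hc, hfst⟩, hk'⟩ := hc
        obtain ⟨-, hitem, hrest⟩ := split_mem hI hIne hc hfst
        rw [hk'] at hitem hrest
        rw [Finset.mem_coe, Finset.mem_product, mem_itemSet, mem_gSet]
        exact ⟨hitem, hrest⟩
      · rintro ⟨item, rest⟩ hp
        rw [Finset.mem_coe, Finset.mem_product, mem_itemSet, mem_gSet] at hp
        obtain ⟨hg, hfst⟩ := glue_mem hI hIne hp.1 hp.2 hok
        rw [List.take_append_drop] at hg
        rw [Finset.mem_coe, Finset.mem_filter, hF, Finset.mem_filter, mem_gSet]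
        refine ⟨⟨hg, hfst⟩, ?_⟩
        show (sw (resC (glueC I rest item) I)).length = k
        rw [resC_glueC_right, hp.1.2.1, List.length_take, min_eq_left (by omega)]
      · intro c hc
        rw [Finset.mem_coe, Finset.mem_filter, hF, Finset.mem_filter, mem_gSet] at hc
        have hcl : Closed c.1 I := hc.1.2 ▸ closed_fstItem c
        exact glueC_resC hc.1.1.1 hcl
      · rintro ⟨item, rest⟩ -
        exact Prod.ext resC_glueC_right resC_glueC_left
    · rw [zero_mul, Finset.card_eq_zero, Finset.eq_empty_iff_forall_notMem]
      intro c hc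
      rw [Finset.mem_filter, hF, Finset.mem_filter, mem_gSet] at hc
      obtain ⟨⟨hc, hfst⟩, hk'⟩ := hc
      have := (split_mem hI hIne hc hfst).1
      rw [hk'] at this
      exact hok this
  · intro c hc
    rw [Finset.mem_coe, Finset.mem_filter, mem_gSet] at hc
    rw [Finset.mem_coe]
    show (sw (resC c I)).length ∈ Finset.range (S.length + 1)
    rw [Finset.mem_range, Nat.lt_succ_iff]
    have hcl : Closed c.1 I := hc.2 ▸ closed_fstItem c
    have := length_sw_resC_le hcl
    rw [hc.1.2.1] at this
    exact this

/-! ### Initial segments of `Fin N` -/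

/-- The initial segment of `Fin N` of size `N₁`. [folklore] -/
def pref (N N₁ : ℕ) : Finset (Fin N) := Finset.univ.filter fun x => (x : ℕ) < N₁

/-- Membership in `pref`. [folklore] -/
theorem mem_pref {N N₁ : ℕ} {x : Fin N} : x ∈ pref N N₁ ↔ (x : ℕ) < N₁ := by
  simp [pref]

/-- `pref` is an initial segment. [folklore] -/
theorem init_pref (N N₁ : ℕ) : Init (pref N N₁) := fun _ hx _ hyx =>
  mem_pref.2 (lt_of_le_of_lt (Fin.le_def.1 hyx) (mem_pref.1 hx))

/-- The size of `pref`. [folklore] -/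
theorem card_pref {N N₁ : ℕ} (h : N₁ ≤ N) : (pref N N₁).card = N₁ := by
  have : pref N N₁ = Finset.univ.map (Fin.castLEEmb h) := by
    ext x
    rw [mem_pref, Finset.mem_map]
    constructor
    · intro hx; exact ⟨⟨x, hx⟩, Finset.mem_univ _, Fin.ext rfl⟩
    · rintro ⟨y, -, rfl⟩; exact y.2
  rw [this, Finset.card_map, Finset.card_univ, Fintype.card_fin]

/-- A non-empty initial segment of `Fin N` is `pref` of its size. [folklore] -/
theorem eq_pref_of_init {N : ℕ} {I : Finset (Fin N)} (hi : Init I) (hne : I.Nonempty) : I = pref N I.card := by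
  set M := I.max' hne
  have hIic : I = Finset.Iic M := by
    ext x
    rw [Finset.mem_Iic]
    exact ⟨fun hx => Finset.le_max' _ _ hx, fun hx => hi (Finset.max'_mem _ _) hx⟩
  have hcard : I.card = (M : ℕ) + 1 := by rw [hIic, Fin.card_Iic]
  rw [hcard]
  ext x
  rw [hIic, Finset.mem_Iic, mem_pref, Nat.lt_succ_iff]
  exact Fin.le_def

/-- `pref N N₁` is everything iff `N₁ = N` (`N₁ ≤ N`). [folklore] -/
theorem pref_eq_univ_iff {N N₁ : ℕ} (h : N₁ ≤ N) : pref N N₁ = Finset.univ ↔ N₁ = N := by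
  constructor
  · intro hu
    have := card_pref h
    rw [hu, Finset.card_univ, Fintype.card_fin] at this
    exact this.symm
  · rintro rfl
    exact Finset.eq_univ_of_forall fun x => mem_pref.2 x.2

/-! ### The recursion -/

open Classical in
/-- The summand of the first-item recursion. [folklore] -/
noncomputable def gTerm (top : Bool) (W : List ℤ) (wP : Option ℤ) (S : List Bool) (N N₁ k : ℕ) : ℕ :=
  (if CondOK top W wP (lwt (S.take k)) (N₁ = N) then 1 else 0) *
    (iCount (S.take k) N₁ * gCount top (W2 W wP (lwt (S.take k))) (wP2 wP (lwt (S.take k))) (S.drop k) (N - N₁))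

open Classical in
/-- **The first-item recursion**: for `N ≥ 1`,
`gCount top W wP S N = Σ_{N₁=1}^{N} Σ_{k ≤ |S|} [CondOK_k (N₁ = N)] · iCount (S.take k) N₁ · gCount top W₂ wP₂ (S.drop k) (N − N₁)`. [folklore] -/
theorem gCount_succ (top : Bool) (W : List ℤ) (wP : Option ℤ) (S : List Bool) (N : ℕ) (hN : 1 ≤ N) :
    gCount top W wP S N = ∑ N₁ ∈ Finset.Icc 1 N, ∑ k ∈ Finset.range (S.length + 1), gTerm top W wP S N N₁ k := by
  classical
  unfold gCount
  have hu : (Finset.univ : Finset (Fin N)).Nonempty := ⟨⟨0, hN⟩, Finset.mem_univ _⟩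
  -- sort by the first item, an initial segment
  set segs : Finset (Finset (Fin N)) := Finset.univ.filter fun I => I.Nonempty ∧ Init I with hsegs
  rw [Finset.card_eq_sum_card_fiberwise (f := fun c : Cfg (Fin N) => fstItem c) (t := segs)]
  · -- reindex the initial segments by their size
    refine Finset.sum_nbij' (fun I => I.card) (fun N₁ => pref N N₁) ?_ ?_ ?_ ?_ ?_
    · intro I hI
      rw [hsegs, Finset.mem_filter] at hI
      rw [Finset.mem_Icc]
      exact ⟨Finset.card_pos.2 hI.2.1, (Finset.card_le_univ I).trans_eq (Fintype.card_fin N)⟩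
    · intro N₁ hN₁
      rw [Finset.mem_Icc] at hN₁
      rw [hsegs, Finset.mem_filter]
      exact ⟨Finset.mem_univ _, Finset.card_pos.1 (by rw [card_pref hN₁.2]; exact hN₁.1), init_pref N N₁⟩
    · intro I hI
      rw [hsegs, Finset.mem_filter] at hI
      exact (eq_pref_of_init hI.2.2 hI.2.1).symm
    · intro N₁ hN₁
      rw [Finset.mem_Icc] at hN₁
      exact card_pref hN₁.2
    · intro I hI
      rw [hsegs, Finset.mem_filter] at hI
      obtain ⟨-, hne, hi⟩ := hI
      rw [card_filter_fstItem hi hne]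
      refine Finset.sum_congr rfl fun k _ => ?_
      have hle : I.card ≤ N := (Finset.card_le_univ I).trans_eq (Fintype.card_fin N)
      have huniv : (I = Finset.univ) = (I.card = N) := by
        rw [eq_pref_of_init hi hne, card_pref hle]
        exact propext (pref_eq_univ_iff hle)
      unfold gTerm
      rw [card_itemSet_coe, card_gSet_coe, Finset.card_compl, Fintype.card_fin, huniv]
  · intro c _
    rw [Finset.mem_coe]
    show fstItem c ∈ segs
    rw [hsegs, Finset.mem_filter]
    exact ⟨Finset.mem_univ _, fstItem_nonempty c hu, init_fstItem c⟩

/-- **The empty word**: `gCount top W wP S 0 = [S = []]`. [folklore] -/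
theorem gCount_zero (top : Bool) (W : List ℤ) (wP : Option ℤ) (S : List Bool) :
    gCount top W wP S 0 = if S = [] then 1 else 0 := by
  classical
  unfold gCount
  have hsw : ∀ c : Cfg (Fin 0), sw c = [] := fun c => by
    rw [← List.length_eq_zero_iff, length_sw, Finset.card_eq_zero]
    exact Finset.eq_empty_of_isEmpty _
  have hall : ∀ c : Cfg (Fin 0), IsGCfg top W wP [] c := fun c =>
    ⟨⟨fun t => t.elim0, fun t => t.elim0⟩, hsw c,
      ⟨fun _ I hne => absurd hne (by simp [Finset.eq_empty_of_isEmpty I]),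
        fun _ I hne => absurd hne (by simp [Finset.eq_empty_of_isEmpty I])⟩,
      fun I hne => absurd hne (by simp [Finset.eq_empty_of_isEmpty I]),
      fun _ _ I hne => absurd hne (by simp [Finset.eq_empty_of_isEmpty I])⟩
  split_ifs with hS
  · subst hS
    have : gSet top W wP [] (Fin 0) = Finset.univ := Finset.eq_univ_of_forall fun c => mem_gSet.2 (hall c)
    rw [this, Finset.card_univ]
    simp
  · rw [Finset.card_eq_zero, Finset.eq_empty_iff_forall_notMem]
    intro c hc
    rw [mem_gSet] at hc
    exact hS (hc.2.1.symm.trans (hsw c))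

/-! ### Item counts -/

/-- No items on no points. [folklore] -/
theorem iCount_zero (T : List Bool) : iCount T 0 = 0 := by
  classical
  unfold iCount
  rw [Finset.card_eq_zero, Finset.eq_empty_iff_forall_notMem]
  intro c hc
  rw [mem_itemSet] at hc
  rcases hc.2.2.2 with ⟨⟨t, _⟩, _⟩ | h
  · exact t.elim0
  · simp at h

/-- No arch configurations on no points. [folklore] -/
theorem eCount_zero (T : List Bool) : eCount T 0 = 0 := by
  classical
  unfold eCount
  rw [Finset.card_eq_zero, Finset.eq_empty_iff_forall_notMem]
  intro c hc
  rw [mem_eSet] at hc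
  obtain ⟨t, _⟩ := hc.2.2.1.1
  exact t.elim0

/-- No arch configurations on one point. [folklore] -/
theorem eCount_one (T : List Bool) : eCount T 1 = 0 := by
  classical
  unfold eCount
  rw [Finset.card_eq_zero, Finset.eq_empty_iff_forall_notMem]
  intro c hc
  rw [mem_eSet] at hc
  obtain ⟨t, ht⟩ := hc.2.2.1.1
  exact ht (Subsingleton.elim _ _)

/-- Items on at least two points are arch configurations. [folklore] -/
theorem iCount_add_two (T : List Bool) (N : ℕ) : iCount T (N + 2) = eCount T (N + 2) := by
  classical
  unfold iCount eCount
  congr 1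
  ext c
  rw [mem_itemSet, mem_eSet]
  unfold IsItem IsECfg
  have : Fintype.card (Fin (N + 2)) ≠ 1 := by simp
  constructor
  · rintro ⟨h1, h2, h3, h4 | h4⟩
    · exact ⟨h1, h2, h4, h3⟩
    · exact absurd h4 this
  · rintro ⟨h1, h2, h3, h4⟩
    exact ⟨h1, h2, h4, Or.inl h3⟩

/-- **Items on one point are single letters**: `iCount T 1 = [|T| = 1]`. [folklore] -/
theorem iCount_one (T : List Bool) : iCount T 1 = if T.length = 1 then 1 else 0 := by
  classical
  unfold iCount
  -- every configuration on one point is an item with sign word `[σ 0]`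
  have hid : ∀ c : Cfg (Fin 1), ∀ t, c.1 t = t := fun c t => Subsingleton.elim _ _
  have hsw : ∀ c : Cfg (Fin 1), sw c = [c.2 0] := fun c => by
    unfold sw
    have : letters c = {0} := by
      ext t; rw [mem_letters, Finset.mem_singleton]; exact ⟨fun _ => Subsingleton.elim _ _, fun _ => hid c t⟩
    rw [this, Finset.sort_singleton]
    rfl
  have hitem : ∀ c : Cfg (Fin 1), IsItem [c.2 0] c := fun c =>
    ⟨⟨fun t => by rw [hid, hid], fun t ht => absurd (hid c t) ht⟩, hsw c,
      fun I hne hnu _ _ => absurd (Finset.eq_univ_of_forall fun t => by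
        obtain ⟨s, hs⟩ := hne; rwa [Subsingleton.elim t s]) hnu,
      Or.inr (by simp)⟩
  split_ifs with hT
  · obtain ⟨b, rfl⟩ : ∃ b, T = [b] := by
      match T, hT with
      | [b], _ => exact ⟨b, rfl⟩
    rw [Finset.card_eq_one]
    refine ⟨(id, fun _ => b), Finset.ext fun c => ?_⟩
    rw [mem_itemSet, Finset.mem_singleton]
    constructor
    · intro h
      have h2 := (hsw c).symm.trans h.2.1
      simp only [List.cons.injEq, and_true] at h2
      refine Prod.ext (funext fun t => (hid c t).trans rfl) (funext fun t => ?_)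
      rw [Subsingleton.elim t 0, h2]
    · rintro rfl
      exact hitem _
  · rw [Finset.card_eq_zero, Finset.eq_empty_iff_forall_notMem]
    intro c hc
    rw [mem_itemSet] at hc
    apply hT
    rw [← hc.2.1, hsw]
    rfl

end Summit.CriticalPhenomena.PercolationContinuityZ3.Theorems.Pcint.ChordDiag
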